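import Summits.CriticalPhenomena.SAWScalingLimit.Theses.SAWDefectDecoherence
import Literature.Analysis.Complex.SchwarzReflection

/-!
# `BoundaryClosureR`, line `pick-half-plane`, stub `stub_identification`: the reflection step of
# the closing argument — constant boundary values on the flat gate force a constant

Sub-goal `identification_gateReflection` of the stub `stub_identification` (crux
stmt-CriticalPhenomena-14004): the "Schwarz reflection + identity theorem" step of the sibling line's
`stub_closingArgument`, in tree vocabulary.  For a Dobrushin domain `D` whose carrier is, inside the
ball `B(D.pt 1, ρ)`, exactly the open half-plane above the normaliser `D.pt 1` (the GATE hypothesis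
of `AdmissibleFamily` / `HexObservableLimitR`), a function `G` holomorphic on the carrier which tends
to the same constant `K` at every point of the flat gate `{im z = im (D.pt 1)} ∩ B(D.pt 1, ρ)` (limits
within the carrier) is identically `K` on the carrier.  Applied to `G := g · exp(−(5/8)(L − L_b))`
this closes the identification once the boundary trace of `g` (modulus AND phase) along the gate is
known; together with `identification_of_modulusPhase` (interior modulus version) these are the two
purely function-theoretic exits of the Pick closing argument.

Proof: translate the gate to the real axis (`w ↦ w + D.pt 1` maps the upper half of `B(0, ρ)`
onto `carrier ∩ B(D.pt 1, ρ)`), extend `G(· + D.pt 1) − K` by `0` on the diameter — continuous up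
to the diameter by the hypothesis — and reflect (`Complex.differentiableOn_schwarzReflection`, the
tree's Schwarz reflection principle); the reflected function is holomorphic on `B(0, ρ)` and
vanishes on the diameter, hence on the ball (isolated zeros), so `G = K` on
`carrier ∩ B(D.pt 1, ρ)`, a nonempty open subset of the connected carrier, and the identity theorem
concludes.  References: Conway, *Functions of One Complex Variable I* (1978), IX.1.1 (reflection);
the statement is route bookkeeping of ideas `two-root-quotient` / `pick-half-plane`.
-/

noncomputable section

open scoped Topology ComplexConjugate
open Filter Set Metric Complex
open Literature.Probability.RandomPlanarGeometry

namespace Summit.CriticalPhenomena.SAWScalingLimit.Theorems.PickHalfPlane.Identification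

/-- **Reflection across the flat gate (sub-goal `identification_gateReflection` of stub
`stub_identification`).** Let `D` be a Dobrushin domain with
`D.carrier ∩ B(D.pt 1, ρ) = {im z > im (D.pt 1)} ∩ B(D.pt 1, ρ)` (`ρ > 0`), `G` holomorphic on the
carrier, and `K` a constant such that `G → K` within the carrier at EVERY point of the flat gate
`{im z = im (D.pt 1)} ∩ B(D.pt 1, ρ)`.  Then `G = K` on the whole carrier (Schwarz reflection of
`G(· + D.pt 1) − K`, extended by `0` on the diameter of `B(0, ρ)`; isolated zeros on the ball; identity
theorem on the connected carrier). [folklore] -/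
theorem identification_gateReflection : ∀ (D : DobrushinDomain) (ρ : ℝ) (G : ℂ → ℂ) (K : ℂ),
    0 < ρ → D.carrier ∩ Metric.ball (D.pt 1) ρ = {z : ℂ | (D.pt 1).im < z.im} ∩ Metric.ball (D.pt 1) ρ →
    DifferentiableOn ℂ G D.carrier →
    (∀ y : ℂ, y.im = (D.pt 1).im → y ∈ Metric.ball (D.pt 1) ρ → Tendsto G (𝓝[D.carrier] y) (𝓝 K)) →
    ∀ z ∈ D.carrier, G z = K := by
  intro D ρ G K hρ hflat hG hb
  set p : ℂ := D.pt 1 with hp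
  have hU : IsOpen D.carrier := D.isOpen
  -- points of the upper half of `B(0, ρ)` translate into the carrier
  have hmem : ∀ w : ℂ, w ∈ ball (0 : ℂ) ρ → 0 < w.im → w + p ∈ D.carrier := by
    intro w hw hwim
    have h1 : w + p ∈ {z : ℂ | p.im < z.im} ∩ ball p ρ := by
      refine ⟨by simp [hwim], ?_⟩
      rw [mem_ball, dist_eq_norm, add_sub_cancel_right]; rwa [mem_ball_zero_iff] at hw
    rw [← hflat] at h1
    exact h1.1
  -- the translated function, extended by `0` on and below the real axis
  set f₀ : ℂ → ℂ := fun w => if 0 < w.im then G (w + p) - K else 0 with hf₀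
  have hUo : IsOpen (ball (0 : ℂ) ρ ∩ {z : ℂ | 0 < z.im}) :=
    isOpen_ball.inter (isOpen_lt continuous_const continuous_im)
  have hFd : DifferentiableOn ℂ (fun w => G (w + p) - K) (ball (0 : ℂ) ρ ∩ {z : ℂ | 0 < z.im}) := by
    intro w hw
    have hGw : DifferentiableAt ℂ G (w + p) :=
      (hG _ (hmem w hw.1 hw.2)).differentiableAt (hU.mem_nhds (hmem w hw.1 hw.2))
    exact ((hGw.comp w ((differentiableAt_id).add_const p)).sub_const K).differentiableWithinAt
  have hd : DifferentiableOn ℂ f₀ (ball (0 : ℂ) ρ ∩ {z : ℂ | 0 < z.im}) :=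
    hFd.congr fun w hw => if_pos hw.2
  -- the limit `G → K` at the gate, transported: `f₀ → 0` at real points of the ball from above
  have hlim : ∀ w : ℂ, w ∈ ball (0 : ℂ) ρ → w.im = 0 →
      Tendsto f₀ (𝓝[ball (0 : ℂ) ρ ∩ {z : ℂ | 0 < z.im}] w) (𝓝 0) := by
    intro w hw hwim
    have hy : Tendsto G (𝓝[D.carrier] (w + p)) (𝓝 K) := by
      refine hb (w + p) (by simp [hwim]) ?_
      rw [mem_ball, dist_eq_norm, add_sub_cancel_right]; rwa [mem_ball_zero_iff] at hw
    have htr : Tendsto (fun w' : ℂ => w' + p) (𝓝[ball (0 : ℂ) ρ ∩ {z : ℂ | 0 < z.im}] w)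
        (𝓝[D.carrier] (w + p)) := by
      refine tendsto_nhdsWithin_of_tendsto_nhds_of_eventually_within _
        (((continuous_id.add continuous_const).tendsto w).mono_left nhdsWithin_le_nhds) ?_
      exact eventually_mem_nhdsWithin.mono fun w' hw' => hmem w' hw'.1 hw'.2
    have h1 : Tendsto (fun w' => G (w' + p) - K) (𝓝[ball (0 : ℂ) ρ ∩ {z : ℂ | 0 < z.im}] w)
        (𝓝 (K - K)) := (hy.comp htr).sub_const K
    rw [sub_self] at h1
    exact h1.congr' (eventually_mem_nhdsWithin.mono fun w' hw' => (if_pos hw'.2).symm)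
  have hc : ContinuousOn f₀ (ball (0 : ℂ) ρ ∩ {z : ℂ | 0 ≤ z.im}) := by
    intro w hw
    rcases lt_or_eq_of_le (show 0 ≤ w.im from hw.2) with hpos | hzero
    · -- above the axis: `f₀` is the holomorphic `F` near `w`
      have hcont : ContinuousAt f₀ w :=
        (hd.continuousOn.continuousAt (hUo.mem_nhds ⟨hw.1, hpos⟩))
      exact hcont.continuousWithinAt
    · -- on the axis: the value is `0`, the limit from above is `0`, and `f₀ = 0` on the axis
      have hw0 : f₀ w = 0 := if_neg (by rw [← hzero]; exact lt_irrefl _)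
      have hsub : ball (0 : ℂ) ρ ∩ {z : ℂ | 0 ≤ z.im} ⊆
          (ball (0 : ℂ) ρ ∩ {z : ℂ | 0 < z.im}) ∪ {z : ℂ | z.im = 0} := by
        rintro z ⟨hz, hzim⟩
        rcases lt_or_eq_of_le (show 0 ≤ z.im from hzim) with h | h
        · exact Or.inl ⟨hz, h⟩
        · exact Or.inr h.symm
      refine ContinuousWithinAt.mono ?_ hsub
      refine ContinuousWithinAt.union ?_ ?_
      · rw [ContinuousWithinAt, hw0]; exact hlim w hw.1 hzero.symm
      · refine (continuousWithinAt_const (b := (0 : ℂ))).congr (fun z hz => ?_) hw0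
        exact if_neg (by rw [show z.im = 0 from hz]; exact lt_irrefl _)
  have hreal : ∀ z ∈ ball (0 : ℂ) ρ, z.im = 0 → conj (f₀ z) = f₀ z := by
    intro z _ hz
    have : f₀ z = 0 := if_neg (by rw [hz]; exact lt_irrefl _)
    rw [this, map_zero]
  have hsymm : ∀ z ∈ ball (0 : ℂ) ρ, conj z ∈ ball (0 : ℂ) ρ := fun z hz => by
    rwa [mem_ball_zero_iff, norm_conj, ← mem_ball_zero_iff]
  -- Schwarz reflection: the reflected function is holomorphic on the ball and vanishes on the diameter
  have hR : DifferentiableOn ℂ (schwarzReflection f₀) (ball (0 : ℂ) ρ) :=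
    differentiableOn_schwarzReflection isOpen_ball hsymm hc hd hreal
  have hRx : ∀ x : ℝ, schwarzReflection f₀ x = 0 := fun x => by
    rw [schwarzReflection_ofReal]; exact if_neg (by simp)
  -- isolated zeros: the reflected function vanishes on the ball
  have hR0 : EqOn (schwarzReflection f₀) 0 (ball (0 : ℂ) ρ) := by
    refine (hR.analyticOnNhd isOpen_ball).eqOn_zero_of_preconnected_of_frequently_eq_zero
      (convex_ball (0 : ℂ) ρ).isPreconnected (mem_ball_self hρ) ?_
    -- along the real sequence `ρ/2 · 1/(n+1) → 0`
    set x : ℕ → ℝ := fun n => ρ / 2 * (1 / ((n : ℝ) + 1)) with hx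
    have hxpos : ∀ n, 0 < x n := fun n => by rw [hx]; positivity
    have hx0 : Tendsto (fun n => ((x n : ℝ) : ℂ)) atTop (𝓝 0) := by
      have h1 : Tendsto x atTop (𝓝 (ρ / 2 * 0)) :=
        tendsto_const_nhds.mul tendsto_one_div_add_atTop_nhds_zero_nat
      rw [mul_zero] at h1
      have := (continuous_ofReal.tendsto 0).comp h1
      rwa [ofReal_zero] at this
    have hxt : Tendsto (fun n => ((x n : ℝ) : ℂ)) atTop (𝓝[≠] 0) :=
      tendsto_nhdsWithin_iff.2 ⟨hx0, Eventually.of_forall fun n => by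
        simpa using (hxpos n).ne'⟩
    exact hxt.frequently (Eventually.of_forall fun n => hRx (x n)).frequently
  -- hence `G = K` on the upper half-ball part of the carrier
  have hloc : ∀ w : ℂ, w ∈ ball (0 : ℂ) ρ → 0 < w.im → G (w + p) = K := by
    intro w hw hwim
    have h1 : schwarzReflection f₀ w = 0 := hR0 hw
    rw [schwarzReflection_of_nonneg hwim.le] at h1
    have h2 : f₀ w = G (w + p) - K := if_pos hwim
    exact sub_eq_zero.1 (h2 ▸ h1)
  -- identity theorem on the connected carrier
  have hA : AnalyticOnNhd ℂ (fun z => G z - K) D.carrier := (hG.sub_const K).analyticOnNhd hU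
  set z₀ : ℂ := (ρ / 2 : ℝ) * I + p with hz₀
  have hw₀ : ((ρ / 2 : ℝ) : ℂ) * I ∈ ball (0 : ℂ) ρ := by
    rw [mem_ball_zero_iff, norm_mul, norm_real, norm_I, mul_one, Real.norm_eq_abs, abs_of_pos (by positivity)]
    linarith
  have hw₀im : 0 < (((ρ / 2 : ℝ) : ℂ) * I).im := by simp [hρ]
  have hz₀U : z₀ ∈ D.carrier := hmem _ hw₀ hw₀im
  have hev : (fun z => G z - K) =ᶠ[𝓝 z₀] 0 := by
    -- near `z₀`, `z - p` stays in the upper half-ball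
    have hopen : IsOpen ((fun z => z - p) ⁻¹' (ball (0 : ℂ) ρ ∩ {z : ℂ | 0 < z.im})) :=
      hUo.preimage (continuous_id.sub continuous_const)
    have hz₀' : z₀ ∈ (fun z => z - p) ⁻¹' (ball (0 : ℂ) ρ ∩ {z : ℂ | 0 < z.im}) := by
      rw [mem_preimage, hz₀, add_sub_cancel_right]; exact ⟨hw₀, hw₀im⟩
    filter_upwards [hopen.mem_nhds hz₀'] with z hz
    have := hloc (z - p) hz.1 hz.2
    rw [sub_add_cancel] at this
    simp [this]
  have hzero := hA.eqOn_zero_of_preconnected_of_eventuallyEq_zero D.isConnected.isPreconnected hz₀U hev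
  intro z hz
  exact sub_eq_zero.1 (hzero hz)

end Summit.CriticalPhenomena.SAWScalingLimit.Theorems.PickHalfPlane.Identification

end
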